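import Summits.BirchSwinnertonDyer.Rank1Residual.Supersingular.X6RankOneStepL
import Summits.BirchSwinnertonDyer.Rank1Residual.Partition.MainConjecturesAnticyclotomicGood
import Literature.NumberTheory.EllipticCurves.NeronIsogenyScalingHoldsProofs
import HarnessLib

/-!
# Class X6 (good supersingular, semistable), analytic rank `1`, `p ≥ 5`: one level BELOW STEP L —
# the lower half of `BSD(E,p)` from the two ANTICYCLOTOMIC LINKS AS TYPED ON THE CONSTRUCTED `X_ac`
# ((IMC≥∘BDP) + (CTL)), the supersingular twin of the GLUE seat's A4 for rows C2 / C3-ordinary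
# (cell `b2b-bsdres`, literature typer seat `lit-cw` = Castella–Wan / Wan-line papers, gen 6)

HONEST FRAMING (cell `b2b-bsdres`, run/shared/lean/b2b/bsd-rank1-residual/, verbatim in every
file): the goal of the cell is to DELETE the COMBINATION-SHAPED residual classes of the
Birch–Swinnerton-Dyer formula for ALL analytic-rank `≤ 1` elliptic curves over `ℚ` — "full BSD
formula for every rank `≤ 1` curve in class `C`" assembled STRICTLY from published theorems — so
that the rank-`≤ 1` remainder becomes exactly the CONSTRUCTION-SHAPED classes, which are TYPED
(missing-input `Prop`s), NOT attempted. This is not "finishing BSD". Research routes; no claim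
beyond stated classes. THEOREMS ONLY (no definition, no named fact, no `sorry`); nothing about any
curve is asserted; nothing is booked; no label is moved by this file (the referee rules); X6 ∩
{`r_an = 1`} stays CONSTRUCTION-SHAPED. NEW WORK of the cell (compositions of decls already in the
tree), hence under `Summits/`.

## What this file records (numbers/decls, not adjectives)

The companion `Supersingular/X6RankOneStepL.lean` (p241685) derived the LOWER half
`Typed.MissingLowerBoundAt W p` on `ClassX6 W p ∧ r_an = 1 ∧ p ≥ 5` from ONE typed input, STEP L
= `X11b.IndexLowerBoundAt W p K P` (JSW 2017 (eq:shalowerK-1)) at every Manin-unit classical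
Heegner datum, everything else published by name. The GLUE seat's gen-3 files
`Partition/MainConjecturesAnticyclotomicGood{,Class}.lean` (p244084 / p244165, rows C2 / C3-ordinary) went one
level below STEP L at a GOOD prime: STEP L at a datum ⇐ the two antecedents AS TYPED ON THE TREE'S
CONSTRUCTED `Λ`-module `X_ac = AcSelmer.XAc (E_K) p κ 𝔭 ∅ γ` —
* (CTL)ᵍ `X11b.ControlOnTreeGoodAt p κ 𝔭 γ ι P` — the anticyclotomic control theorem, `Σ = ∅`,
  in valuations;
* (IMC≥∘BDP)ᵍ `X11b.IMCLowerWaldspurgerOnTreeGoodAt p κ 𝔭 γ ι P` — ONE divisibility of the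
  anticyclotomic (BDP / Iwasawa–Greenberg) main conjecture at the trivial character, composed with
  the BDP formula: `2·(ord_p log_ω P + ord_p(1 − a_p + p) − 1) ≤ ord_p f(0)`;
and noted "the definition [of `X_ac`] does not see the reduction type at `p`". NEITHER PREDICATE
MENTIONS ORDINARITY: they are shapes on `X_ac` with the anomaly term `ord_p(1 − a_p + p)` as a
parameter. This file is their SUPERSINGULAR reading (the C3-supersingular sub-row = X6 ∩ {r_an = 1},
left untouched by the GLUE seat):

1. `X6.frobeniusTrace_eq_zero_of_five_le`, `X6.padicValInt_anomaly_eq_zero` — on X6 with `p ≥ 5`,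
   `a_p = 0` (Hasse) and the anomaly term VANISHES: `ord_p(1 − a_p + p) = ord_p(1 + p) = 0`
   (JSW 2017 §3.5, p. 16 of arXiv:1512.06894: "`A_f(ℚ_p)/A_f^1(ℚ_p) ⊗ 𝒪 ≅ A_f[𝔭^∞](𝔽_p)`. The
   latter group is trivial unless `f` is ordinary"); so `X6.controlOnTreeGoodAt_iff` /
   `X6.imcLowerWaldspurgerOnTreeGoodAt_iff` display the two links AS READ at a supersingular `p`:
   local term `ord_p log_ω P − 1`, inequality `2·(ord_p log_ω P − 1) ≤ ord_p f(0)`.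
2. `X6.missingLowerBoundAt_of_onTreeGoodLinksAt` (datum) and `X6.missingLowerBoundAt_of_onTreeGoodLinks`
   (class level: `ClassX6 W p → 5 ≤ p → r_an = 1 → MissingLowerBoundAt W p`) — gen 3's STEP-L
   theorems with the binder `hL` REPLACED by (`hLC`, `hLA`) demanded, for the pair at hand, at every
   Manin-unit classical Heegner datum over an imaginary quadratic `K` with `d_K < −4`, every `ℓ ∣ N`
   split, `p` split, `L(E^{d_K},1) ≠ 0`, at the (non-torsion) Heegner point, for every anticyclotomic
   `κ`, generator `γ`, degree-one `𝔭 ∋ p`, with THE embedding `X11b.embAt K p 𝔭` — the binder shape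
   of the GLUE seat's `bsdp_rankOne_of_onTreeGoodLinks_of_columnMainConjecture` (minus `Odd d_K`,
   which the Friedberg–Hoffstein fact used here does not supply). The Néron-scaling binder `hNS` of
   gen 3 is DISCHARGED (`integral_neronScaling_of_isGloballyMinimal_holds`, multr1-p2 gen 18).
3. (companion `Supersingular/X6RankOneAnticyclotomicLinksClass.lean`) `X6.bsdp_of_onTreeGoodLinks_of_sprung`
   — with Sprung 2024 Cor. 1.3 (ii) for the upper half, `BSD(E,p)` on X6 ∧ {r_an = 1} ∧ {p ≥ 5};
   `RowC3.bsdp_of_goodSS_of_onTreeGoodLinks_of_sprung` — the same on row C3 ∩ {supersingular, p ≥ 5}.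
4. `X6.indexLowerBoundAt_iff_imcLowerWaldspurger_of_control` — at an X6 Heegner datum (finiteness of
   `Ш(E/K)` DISCHARGED by Gross–Zagier + Kolyvagin), GIVEN (CTL): STEP L ⟺ (IMC≥∘BDP). So the typed
   residue of X6 ∩ {r_an = 1} at `p ≥ 5` (`MissingLowerBoundAt`, `X6RankOneOneSided.lean`) is, on the
   control theorem, EXACTLY one inequality of the anticyclotomic Iwasawa–Greenberg main conjecture
   at one character on the constructed `X_ac` — no more.
5. (companion) `X6.exists_onTreeLinkData` — NON-VACUITY: at every X6 pair with `r_an = 1`, `p ≥ 5`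
   the data at which (`hLC`, `hLA`) are demanded EXIST (field: Friedberg–Hoffstein; datum: Mazur
   1978 + Néron; non-torsion: Gross–Zagier; `κ, γ, 𝔭`: global reciprocity, `p` split).

## The printed shapes at a SUPERSINGULAR prime, and the TIER (reading for the referee; nothing moved)

* (CTL) at a good supersingular `p` split in `K` IS A PUBLISHED THEOREM: Jetchev–Skinner–Wan,
  Camb. J. Math. 5 (2017) Thm. 3.3.1 (LaTeXML Thm. 8, p. 11 of arXiv:1512.06894: "The `Λ`-module
  `X_ac^Σ(M)` is `Λ`-torsion, and if `f_ac^Σ(T)` is a generator of its characteristic `Λ`-ideal …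
  `#𝒪/f_ac^Σ(0) = #H¹_{F_ac}(K, W) · C^Σ(W)`") is proved under the standing hypotheses of §3.1
  (p. 10, verbatim list): (sst) "`V` is semistable as a representation of `G_{K_w}` for all `w ∣ p`",
  (τ-dual), (2-dim), (HT), (irred_K), (corank 1), (sur) — NO ordinarity hypothesis ("The proof of
  Theorem 1.2.1 in this paper treats the ordinary and supersingular cases the same", p. 3); the local
  term at `v ∣ p` is computed in §3.5 for both cases (quoted in item 1). Castella 2018 Thm. 2.3 (the
  docstring source of the GLUE/multr1 predicate, "`ε_p = p⁻¹` if `p ∤ N`") is the same statement.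
* (IMC≥∘BDP) at a good supersingular `p`: the main-conjecture half is Castella–Wan, Math. Ann. 389
  (2024) **Conj. 5.2** (authors' MS p. 23, verbatim): "The module `X^{rel,str}` is `Λ_ac`-torsion, and
  `char_{Λac}(X^{rel,str})Λ^ur = (L^BDP_p)` as ideals in `Λ^ur`" for the Selmer group of Def. 5.1
  ("`Sel^{rel,str}(K, A^ac)` consists of classes which are trivial at `𝔭̄` and satisfy no condition at
  `𝔭`"), `L^BDP_p = (𝓛^BDP_𝔭)²` (Prop. 2.1: [BDP13] for `N⁻ = 1`, [HB15]/[BCK21 §4] in general);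
  the BDP formula at `𝟙` is Brooks' formula, JSW 2017 Prop. 5.1.x (LaTeXML Prop. 26, p. 22: "Suppose
  (sqfree) holds and `N` and `K` satisfy (gen-H). Then `L_p(f,1) = (1−a_{ℓ₀}+ℓ₀)⁻²·((1+p−a_p)/p)²·
  (log_{ω_f} x_K)²` up to a `p`-adic unit") — (good), no ordinarity. IN REFEREED PRINT the
  divisibility "`⊆`" is **Castella–Wan 2024 Thm. 5.3 ([CLW22])** (MS pp. 23–25, verbatim): "Assume
  that: (i) `N` is squarefree, (ii) some prime `ℓ ∣ N` is non-split in `K`, (iii) if `N` is odd, then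
  `2` splits in `K`. Then `char_{Λac}(X^{rel,str})Λ^ur ⊂ (L^BDP_p)` in `Λ^ur[1/p]`. If in addition
  `E[p]` is ramified at every prime `ℓ ∣ N⁻`, then the divisibility holds in `Λ^ur`" (setting §2:
  `p ≥ 5` good, (gen-H) "`N⁻` is the squarefree product of an even number of primes", (spl); proof
  from Castella–Liu–Wan, Forum Math. Sigma 10 (2022) e110 Thm. 8.2.3 (1) + [SU14 Prop. 3.9] +
  [PW11]/[GV00] + Prop. 2.7 + [Pra06] + Thm. 2.3; authors' 2024 addendum after the [Hid04, Thm. 3.2]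
  gap — cell flags `CW24-CLW22-addendum`, `Hid04-gap`). **Hypothesis (ii) FAILS at the data of this
  file** (every `ℓ ∣ N` split — the tree's classical Heegner datum; cell-lead caveat C186): at an
  all-split `K` and a supersingular `p` NO refereed text prints (IMC≥) [Castella–Çiperiani–Skinner–
  Sprung arXiv:1804.10993 and Burungale–Skinner–Tian–Wan arXiv:2409.01350 are PRE; Burungale–
  Castella–Skinner IMRN 2025 Thm. 1.2.4, the GLUE seat's source at these data, is `p` ORDINARY].
  Hence `hLA` is a TYPED input, every theorem below is CONDITIONAL on it, and X6 ∩ {r_an = 1} stays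
  CONSTRUCTION-SHAPED; what this file changes is only the SHAPE of the typed residue: (STEP L) ↦
  (one inequality of Conj. 5.2 at `𝟙` ∘ Brooks, on the constructed `X_ac`), given the PUBLISHED (CTL).
  Castella–Wan Thm. 5.3 applies verbatim (modulo the object concordance `X^{rel,str}` ↔ `X_ac`,
  `L^BDP_p(𝟙)` ↔ Brooks, CASTELLA-WAN.md §8.3) at a field with a RAMIFIED `q ∥ N` of NONSPLIT
  multiplicative reduction (`N⁻ = 1`, (ii) by `q`, integrality clause vacuous) — the erratum-type
  field of multr1's route R1 (`X11b.IsErratumField`), not the field quantified here; recorded in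
  HOME/b2b-bsdres-lit-cw/CASTELLA-WAN.md §10 as a sized ask, not attempted in this file.

References: [CastellaWan2023] F. Castella, X. Wan, Math. Ann. 389 (2024) 2595–2636, Def. 5.1, Conj.
5.2, Thm. 5.3, Rem. 5.4, Prop. 2.1, Thm. 2.3 (authors' MS pp. 6–7, 23–25); [CastellaLiuWan2022] Thm.
8.2.3; [JetchevSkinnerWan2017] §3.1, Thm. 3.3.1, §3.5, Prop. 5.1.x (Brooks), §7.4.1 (arXiv:1512.06894
pp. 10–11, 16, 22, 29–31); [Castella2018] Thm. 2.3, Thm. 3.2; [Sprung2024] Cor. 1.3 (ii);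
[Wuthrich2014] Prop. 21; [Mazur1978] Cor. 4.1; [Miller2011LMS] Def. 1.1; HOME/b2b-bsdres-lit-glue/GLUE.md
§G2.4 (A4); HOME/b2b-bsdres-lit-cw/CASTELLA-WAN.md §§1, 8, 10.
-/

set_option autoImplicit false

noncomputable section

open scoped Classical

open WeierstrassCurve NumberField IsDedekindDomain Literature.NumberTheory.EllipticCurves
  Literature.NumberTheory.EllipticCurves.ModularForms
  Literature.NumberTheory.EllipticCurves.Rank1Residual
  Literature.NumberTheory.EllipticCurves.Rank1Residual.Typed
  Literature.NumberTheory.EllipticCurves.Wuthrich2014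
  Summit.BirchSwinnertonDyer.Rank1Residual.X11b.AcSelmer

namespace Summit.BirchSwinnertonDyer.Rank1Residual.Supersingular

/-! ### §1 The anomaly term vanishes on X6 (`p ≥ 5`): the two links as read at a supersingular prime -/

section Anomaly

variable (W : WeierstrassCurve ℚ) [W.IsElliptic] [W.IsGloballyMinimal] (p : ℕ) [Fact p.Prime]

/-- On X6 with `p ≥ 5`, `a_p(E) = 0` (good supersingular ⟺ `p ∣ a_p`, and `|a_p| ≤ 2√p < p`, Hasse;
Castella–Wan 2024 p. 3: "`a_p = 0` … automatic if `p > 3`"). [cite: CastellaWan2023, §1 p. 3 ("automatic if p > 3")] -/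
theorem X6.frobeniusTrace_eq_zero_of_five_le (hX : ClassX6 W p) (hp5 : 5 ≤ p) :
    W.frobeniusTrace p = 0 :=
  (W.natCast_dvd_frobeniusTrace_iff_eq_zero p hp5 hX.1.1).mp hX.1.2

/-- **The anomaly term of the two anticyclotomic links VANISHES on X6 (`p ≥ 5`)**:
`ord_p(1 − a_p + p) = ord_p(1 + p) = 0` — JSW 2017 §3.5 (p. 16): "`A_f(𝔽_p) ⊗ 𝒪 = A_f[𝔭^∞](𝔽_p)`.
The latter group is trivial unless `f` is ordinary". [cite: JetchevSkinnerWan2017, §3.5 (arXiv:1512.06894 p. 16)] -/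
theorem X6.padicValInt_anomaly_eq_zero (hX : ClassX6 W p) (hp5 : 5 ≤ p) :
    padicValInt p (1 - W.frobeniusTrace p + p) = 0 := by
  have hp : p.Prime := Fact.out
  rw [X6.frobeniusTrace_eq_zero_of_five_le W p hX hp5, sub_zero]
  refine padicValInt.eq_zero_of_not_dvd ?_
  intro h
  have h1 : (p : ℤ) ∣ 1 := (dvd_add_left (dvd_refl (p : ℤ))).mp h
  have h1' : p ∣ 1 := by exact_mod_cast h1
  exact hp.ne_one (Nat.dvd_one.mp h1')

variable {K : Type} [Field K] [NumberField K]
  (κ : ZpExtension K p) (𝔭 : HeightOneSpectrum (𝓞 K)) (γ : Field.absoluteGaloisGroup K)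
  [Fact (κ.IsTopGenerator γ)] (ι : K →+* ℚ_[p]) (P : (W.baseChange K).toAffine.Point)

/-- **(CTL) as read at a supersingular prime** (X6, `p ≥ 5`): the GLUE seat's
`X11b.ControlOnTreeGoodAt` with the anomaly term gone — `X_ac` torsion with a generator `f`,
`ord_p f(0) = ord_p #Ш(E/K)[p^∞] + 2·((ord_p log_ω P − 1) − ord_p[E(K):ℤP]) + ord_p ∏_{w∣N⁺} c_w(E/K)`
(JSW 2017 Thm. 3.3.1 with the local term of §3.5 at a non-ordinary `p`: `#𝒪/((1+p)/p · log_ω P)`,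
`#H⁰(K_v, W) = 1`). [cite: JetchevSkinnerWan2017, Thm. 3.3.1 (p. 11) and §3.5 (p. 16)] -/
theorem X6.controlOnTreeGoodAt_iff (hX : ClassX6 W p) (hp5 : 5 ≤ p) :
    X11b.ControlOnTreeGoodAt (W := W) p κ 𝔭 γ ι P ↔
      ∃ n : ℕ, XAc.HasCharValuationAt (W.baseChange K) p κ 𝔭 ∅ γ n ∧
        (n : ℤ) = (padicValNat p (Nat.card (AddCommGroup.primaryComponent (W.baseChange K).sha p)) : ℤ) +
          2 * ((X11b.padicLogOrd W p ι P - 1) - (padicValNat p (AddSubgroup.zmultiples P).index : ℤ)) +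
          padicValNat p (X11b.tamagawaProductSplit W K) := by
  unfold X11b.ControlOnTreeGoodAt
  rw [X6.padicValInt_anomaly_eq_zero W p hX hp5]
  simp only [Nat.cast_zero, add_zero]

/-- **(IMC≥∘BDP) as read at a supersingular prime** (X6, `p ≥ 5`): `2·(ord_p log_ω P − 1) ≤ ord_p f(0)`
— Castella–Wan 2024 Conj. 5.2's divisibility "`char(X^{rel,str})Λ^ur ⊂ (L^BDP_p)`" at `𝟙` composed
with Brooks' formula `L_p(f,1) ∼ ((1+p−a_p)/p)²·(log_ω x_K)²` at `a_p = 0`.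
[cite: CastellaWan2023, Conj. 5.2 and Thm. 5.3 (MS p. 23) (shape only; nothing asserted)]
[cite: JetchevSkinnerWan2017, Prop. 5.1.x = LaTeXML Prop. 26 (Brooks' formula, p. 22) (shape only; nothing asserted)] -/
theorem X6.imcLowerWaldspurgerOnTreeGoodAt_iff (hX : ClassX6 W p) (hp5 : 5 ≤ p) :
    X11b.IMCLowerWaldspurgerOnTreeGoodAt (W := W) p κ 𝔭 γ ι P ↔
      ∃ n : ℕ, XAc.HasCharValuationAt (W.baseChange K) p κ 𝔭 ∅ γ n ∧
        2 * (X11b.padicLogOrd W p ι P - 1) ≤ (n : ℤ) := by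
  unfold X11b.IMCLowerWaldspurgerOnTreeGoodAt
  rw [X6.padicValInt_anomaly_eq_zero W p hX hp5]
  simp only [Nat.cast_zero, add_zero]

end Anomaly

/-! ### §2 The lower half on X6 ∧ {r_an = 1} ∧ {p ≥ 5} from the two links on `X_ac` -/

/-- **DATUM level: (IMC≥∘BDP) + (CTL) on the constructed `X_ac` at ONE `(κ, γ, 𝔭, ιp)` ⇒ the typed
lower bound on X6 ∧ {r_an = 1}, `p ≥ 5`.** Data and published inputs exactly as in gen 3's
`X6.missingLowerBoundAt_of_indexLowerBoundAt` (Gross–Zagier `hGZ`, Kolyvagin `hKo`, Wuthrich 2014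
Prop. 21 `hWu` for the twist, GZK `hGZK`, modularity `hmod`; `K` imaginary quadratic with every
`ℓ ∣ N` split, `p` split, Manin-unit datum `Dt`, Heegner point `P`, `p ∤ #𝓞_K^×`, `L(E^{d_K},1) ≠ 0`,
a globally minimal model `Wd` of the twist), with STEP L REPLACED by its two antecedents as typed
on tree objects: `hLA` = (IMC≥∘BDP), `hLC` = (CTL) (the GLUE seat's
`X11b.indexLowerBoundAt_of_heegner_of_onTreeGoodLowerLinks`: finiteness of `Ш(E/K)` from
Gross–Zagier + Kolyvagin at the non-torsion Heegner point). TIER: (CTL) published (JSW Thm. 3.3.1);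
(IMC≥∘BDP) NOT in print at these all-split data at a supersingular `p` (Castella–Wan 2024 Thm. 5.3
needs (ii) a non-split `ℓ ∣ N`) — a TYPED input; CONDITIONAL; nothing booked.
[cite: JetchevSkinnerWan2017, Thm. 3.3.1 (p. 11), §7.4.1 (eq:lowerbound-1)–(eq:shalower) (pp. 30–31)]
[cite: CastellaWan2023, Conj. 5.2, Thm. 5.3 (MS p. 23)] [cite: Wuthrich2014, Prop. 21 (p. 400)]
[cite: Miller2011LMS, Def. 1.1] -/
theorem X6.missingLowerBoundAt_of_onTreeGoodLinksAt
    (W : WeierstrassCurve ℚ) [W.IsElliptic] [W.IsGloballyMinimal] (p : ℕ) [Fact p.Prime]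
    [NeZero (W.conductorNorm ℤ)] (K : Type) [Field K] [NumberField K]
    (Dt : ModularParametrizationData W (W.conductorNorm ℤ))
    (H : HeegnerDatum (W.conductorNorm ℤ) (NumberField.discr K)) (ι : K →+* ℂ)
    (P : (W.baseChange K).toAffine.Point)
    -- the published inputs (named facts of the tree)
    (hGZ : gross_zagier (W.conductorNorm ℤ) W K) (hKo : kolyvagin (W.conductorNorm ℤ) W K)
    (hWu : sha_dvd_analyticSha)
    (hGZK : rank_eq_analyticRank_of_analyticRank_le_one) (hmod : hasEntireLFunction_rat)
    -- the pair
    (hX : ClassX6 W p) (hr : W.analyticRank = 1) (hp5 : 5 ≤ p)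
    -- the Heegner data
    (hK : IsImaginaryQuadratic K) (hHN : SatisfiesHeegnerHypothesis (W.conductorNorm ℤ) K)
    (hHp : SatisfiesHeegnerHypothesis p K)
    (hP : WeierstrassCurve.Affine.Point.map ι.toRatAlgHom P = heegnerPointComplex Dt H)
    (hc : ¬ (p : ℤ) ∣ Dt.c) (hμ : ¬ p ∣ Units.torsionOrder K)
    (hLt : (W.quadraticTwist (NumberField.discr K : ℚ)).entireLFunction 1 ≠ 0)
    (Wd : WeierstrassCurve ℚ) [Wd.IsElliptic] [Wd.IsGloballyMinimal] (Cd : VariableChange ℚ)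
    (hWd : Cd • W.quadraticTwist (NumberField.discr K : ℚ) = Wd)
    -- the two links on `X_ac` at one `(κ, γ, 𝔭, ιp)` (typed inputs)
    {κ : ZpExtension K p} {𝔭 : HeightOneSpectrum (𝓞 K)} {γ : Field.absoluteGaloisGroup K}
    [Fact (κ.IsTopGenerator γ)] {ιp : K →+* ℚ_[p]}
    (hLA : X11b.IMCLowerWaldspurgerOnTreeGoodAt p κ 𝔭 γ ιp P)
    (hLC : X11b.ControlOnTreeGoodAt p κ 𝔭 γ ιp P) :
    MissingLowerBoundAt W p :=
  X6.missingLowerBoundAt_of_indexLowerBoundAt W p K Dt H ι P hGZ hKo hWu hGZK hmod hX hr hp5 hK hHN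
    hHp hP hc hμ hLt Wd Cd hWd
    (X11b.indexLowerBoundAt_of_heegner_of_onTreeGoodLowerLinks W p (W.conductorNorm ℤ) K Dt H ι P
      hGZ hKo hmod hp5 hr rfl hK hHN hLt hP hLA hLC)

/-- **CLASS level: the two links on `X_ac` ⇒ the typed lower bound on the whole of X6 ∧ {r_an = 1}
∧ {p ≥ 5}** — gen 3's `X6.missingLowerBoundAt_of_stepL` with its binder `hL` (STEP L) REPLACED by
(`hLC`, `hLA`) demanded, for THIS pair, at every Manin-unit classical Heegner datum over an imaginary
quadratic `K` with `d_K < −4`, every `ℓ ∣ N` split, `p` split, `L(E^{d_K},1) ≠ 0`, at the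
(non-torsion) Heegner point, for every anticyclotomic `κ`, generator `γ`, degree-one `𝔭 ∋ p`, with
THE embedding `X11b.embAt K p 𝔭` (the binder shape of the GLUE seat's
`bsdp_rankOne_of_onTreeGoodLinks_of_columnMainConjecture`, without `Odd d_K`). Published inputs by
name: Gross–Zagier, Kolyvagin, Wuthrich 2014 Prop. 21, GZK, modularity (`hmod`, `hnf`),
Friedberg–Hoffstein (`hFH`: the field), Mazur 1978 Cor. 4.1 (`hMaz`: the Manin-unit datum via
`X11b.exists_maninDatum_of_good`, with the Néron-scaling fact now a tree THEOREM
`integral_neronScaling_of_isGloballyMinimal_holds`). TIER as in the datum theorem: CONDITIONAL on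
`hLA` (not in print at these data at a supersingular `p`); nothing booked.
[cite: JetchevSkinnerWan2017, Thm. 3.3.1 (p. 11), §7.4.1 (pp. 29–31)] [cite: CastellaWan2023, Conj. 5.2, Thm. 5.3 (MS p. 23)]
[cite: Wuthrich2014, Prop. 21 (p. 400)] [cite: Mazur1978, Cor. 4.1] [cite: Miller2011LMS, Def. 1.1] -/
theorem X6.missingLowerBoundAt_of_onTreeGoodLinks
    -- published inputs (named facts of the tree)
    (hGZ : ∀ (N : ℕ) [NeZero N] (W : WeierstrassCurve ℚ) (K : Type) [Field K] [NumberField K],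
      gross_zagier N W K)
    (hKo : ∀ (N : ℕ) [NeZero N] (W : WeierstrassCurve ℚ) (K : Type) [Field K] [NumberField K],
      kolyvagin N W K)
    (hWu : sha_dvd_analyticSha)
    (hGZK : rank_eq_analyticRank_of_analyticRank_le_one) (hmod : hasEntireLFunction_rat)
    (hnf : exists_isNewformOf)
    (hFH : friedbergHoffstein_exists_heegnerField_split_twist_ne_zero)
    (hMaz : mazur_not_dvd_maninConstant_of_odd)
    -- the pair
    (W : WeierstrassCurve ℚ) [W.IsElliptic] [W.IsGloballyMinimal] (p : ℕ) [Fact p.Prime]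
    (hX : ClassX6 W p) (hp5 : 5 ≤ p) (hr : W.analyticRank = 1)
    -- (CTL) on the constructed `X_ac` at every classical Heegner datum of this pair — PUBLISHED shape
    (hLC : ∀ (N : ℕ) [NeZero N] (K : Type) [Field K] [NumberField K]
      (Dt : ModularParametrizationData W N) (H : HeegnerDatum N (NumberField.discr K)) (ι : K →+* ℂ)
      (P : (W.baseChange K).toAffine.Point),
      W.conductorNorm ℤ = N → IsImaginaryQuadratic K → NumberField.discr K < -4 →
      SatisfiesHeegnerHypothesis N K → SatisfiesHeegnerHypothesis p K →
      (W.quadraticTwist (NumberField.discr K : ℚ)).entireLFunction 1 ≠ 0 →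
      WeierstrassCurve.Affine.Point.map ι.toRatAlgHom P = heegnerPointComplex Dt H →
      ¬ (p : ℤ) ∣ Dt.c → ¬ IsOfFinAddOrder P →
      ∀ (κ : ZpExtension K p), κ.IsAnticyclotomic →
        ∀ (γ : Field.absoluteGaloisGroup K) [Fact (κ.IsTopGenerator γ)]
          (𝔭 : HeightOneSpectrum (𝓞 K)) (h𝔭 : ((p : ℕ) : 𝓞 K) ∈ 𝔭.asIdeal)
          (he : 𝔭.asIdeal.ramificationIdx (𝓞 ℚ) = 1) (hf : 𝔭.asIdeal.inertiaDeg (𝓞 ℚ) = 1),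
          X11b.ControlOnTreeGoodAt p κ 𝔭 γ (X11b.embAt K p 𝔭 h𝔭 he hf) P)
    -- (IMC≥∘BDP) on the constructed `X_ac` at the same data — TYPED input at a supersingular `p`
    (hLA : ∀ (N : ℕ) [NeZero N] (K : Type) [Field K] [NumberField K]
      (Dt : ModularParametrizationData W N) (H : HeegnerDatum N (NumberField.discr K)) (ι : K →+* ℂ)
      (P : (W.baseChange K).toAffine.Point),
      W.conductorNorm ℤ = N → IsImaginaryQuadratic K → NumberField.discr K < -4 →
      SatisfiesHeegnerHypothesis N K → SatisfiesHeegnerHypothesis p K →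
      (W.quadraticTwist (NumberField.discr K : ℚ)).entireLFunction 1 ≠ 0 →
      WeierstrassCurve.Affine.Point.map ι.toRatAlgHom P = heegnerPointComplex Dt H →
      ¬ (p : ℤ) ∣ Dt.c → ¬ IsOfFinAddOrder P →
      ∀ (κ : ZpExtension K p), κ.IsAnticyclotomic →
        ∀ (γ : Field.absoluteGaloisGroup K) [Fact (κ.IsTopGenerator γ)]
          (𝔭 : HeightOneSpectrum (𝓞 K)) (h𝔭 : ((p : ℕ) : 𝓞 K) ∈ 𝔭.asIdeal)
          (he : 𝔭.asIdeal.ramificationIdx (𝓞 ℚ) = 1) (hf : 𝔭.asIdeal.inertiaDeg (𝓞 ℚ) = 1),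
          X11b.IMCLowerWaldspurgerOnTreeGoodAt p κ 𝔭 γ (X11b.embAt K p 𝔭 h𝔭 he hf) P) :
    MissingLowerBoundAt W p := by
  have hp : p.Prime := Fact.out
  have hp2 : p ≠ 2 := by omega
  have hgood : W.HasGoodReductionAtPrime p := hX.1.1
  have hirr : Irr W p := ClassX6.irr W p hp2 hX
  haveI : NeZero (W.conductorNorm ℤ) := ⟨(W.conductorNorm_pos_holds).ne'⟩
  -- the sign of the functional equation is `−1` (modularity, `r_an = 1`)
  have hw : W.rootNumber = -1 := by
    rw [WeierstrassCurve.rootNumber_eq_neg_one_pow_analyticRank_of_exists_isNewformOf hnf W, hr]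
    norm_num
  -- the auxiliary field (Friedberg–Hoffstein): every `ℓ ∣ N` split, `p` split, `|d_K| > 4`,
  -- `L(E^{d_K},1) ≠ 0`
  obtain ⟨K, _, _, hK, hdisc, hHN, hHp, hLt⟩ := hFH W hw p hp 4
  haveI : IsTotallyComplex K := hK.2
  have hneg : NumberField.discr K < 0 := discr_neg_of_finrank_eq_two K hK.1
  have h4 : NumberField.discr K < -4 := by
    have habs : ((NumberField.discr K).natAbs : ℤ) = -NumberField.discr K :=
      Int.ofNat_natAbs_of_nonpos hneg.le
    have : (4 : ℤ) < ((NumberField.discr K).natAbs : ℤ) := by exact_mod_cast hdisc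
    omega
  -- `w_K = 2`, prime to `p ≥ 5`
  have hμ : ¬ p ∣ Units.torsionOrder K := by
    rw [Literature.NumberTheory.DiophantineGeometry.torsionOrder_eq_two_of_discr_lt hK.1 h4]
    intro h2
    have := Nat.le_of_dvd two_pos h2
    omega
  -- the Manin-unit Heegner datum at a good odd prime (Néron scaling is a tree theorem)
  obtain ⟨Dt, H, ι, P, hP, hc⟩ :=
    X11b.exists_maninDatum_of_good hnf hMaz integral_neronScaling_of_isGloballyMinimal_holds W p
      (W.conductorNorm ℤ) K rfl hp2 hgood hirr hK hHN
  -- the Heegner point is non-torsion (Gross–Zagier + modularity)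
  have hPinf : ¬ IsOfFinAddOrder P :=
    X11b.not_isOfFinAddOrder_of_heegner_of_analyticRank_eq_one W (W.conductorNorm ℤ) K Dt H ι P
      (hGZ _ W K) hmod hr hK hHN hLt hP
  -- STEP L at the datum from the two links (finiteness of `Ш(E/K)` discharged there)
  have hL : X11b.IndexLowerBoundAt W p K P :=
    X11b.indexLowerBoundAt_of_heegner_of_onTreeGoodInputs W p (W.conductorNorm ℤ) K Dt H ι P
      (hGZ _ W K) (hKo _ W K) hmod hp5 hr rfl hK hHN hHp hLt hP
      (fun κ hκ γ _ 𝔭 h𝔭 he hf ↦ hLC _ K Dt H ι P rfl hK h4 hHN hHp hLt hP hc hPinf κ hκ γ 𝔭 h𝔭 he hf)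
      (fun κ hκ γ _ 𝔭 h𝔭 he hf ↦ hLA _ K Dt H ι P rfl hK h4 hHN hHp hLt hP hc hPinf κ hκ γ 𝔭 h𝔭 he hf)
  -- a globally minimal model of the twist (Silverman VIII.8 Cor. 8.3)
  have hD0 : (NumberField.discr K : ℚ) ≠ 0 := by exact_mod_cast NumberField.discr_ne_zero K
  haveI hEt : (W.quadraticTwist (NumberField.discr K : ℚ)).IsElliptic :=
    W.isElliptic_quadraticTwist hD0
  obtain ⟨Cd, hCd⟩ := hasGlobalMinimalModel_rat_holds (W.quadraticTwist (NumberField.discr K : ℚ))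
  haveI : (Cd • W.quadraticTwist (NumberField.discr K : ℚ)).IsGloballyMinimal := hCd
  have hWd : Cd • W.quadraticTwist (NumberField.discr K : ℚ) =
      Cd • W.quadraticTwist (NumberField.discr K : ℚ) := rfl
  exact X6.missingLowerBoundAt_of_indexLowerBoundAt W p K Dt H ι P (hGZ _ W K) (hKo _ W K) hWu hGZK
    hmod hX hr hp5 hK hHN hHp hP hc hμ hLt (Cd • W.quadraticTwist (NumberField.discr K : ℚ)) Cd hWd hL

/-! ### §3 Given (CTL), STEP L at an X6 Heegner datum IS the one inequality (IMC≥∘BDP) -/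

/-- **The typed residue of X6 ∩ {r_an = 1} at `p ≥ 5`, refined**: at an X6 Heegner datum (`r_an = 1`,
`K` imaginary quadratic with every `ℓ ∣ N` split, `L(E^{d_K},1) ≠ 0`, `P` the Heegner point —
finiteness of `Ш(E/K)` DISCHARGED by Gross–Zagier + Kolyvagin + modularity, multr1's
`finite_sha_baseChange_of_heegner`), GIVEN the PUBLISHED control theorem (CTL) at `(κ, γ, 𝔭, ιp)`
(JSW 2017 Thm. 3.3.1, no ordinarity hypothesis), STEP L `X11b.IndexLowerBoundAt W p K P` (the typed
input of `X6RankOneStepL.lean`) is EQUIVALENT to the one inequality (IMC≥∘BDP) at that datum — one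
divisibility of Castella–Wan 2024 Conj. 5.2 at the trivial character ∘ Brooks' formula, on the
constructed `X_ac`. The GLUE seat's `X11b.imcLowerWaldspurgerOnTreeGoodAt_iff_indexLowerBoundAt`
with its finiteness instance supplied. [cite: JetchevSkinnerWan2017, Thm. 3.3.1 (p. 11), §7.4.1 (p. 30)]
[cite: CastellaWan2023, Conj. 5.2 (MS p. 23)] [cite: Kolyvagin1990, Thm. A] [cite: GrossLMS1991, Thm. 1.3] -/
theorem X6.indexLowerBoundAt_iff_imcLowerWaldspurger_of_control
    (W : WeierstrassCurve ℚ) [W.IsElliptic] [W.IsGloballyMinimal] (p : ℕ) [Fact p.Prime]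
    (N : ℕ) [NeZero N] (K : Type) [Field K] [NumberField K]
    (Dt : ModularParametrizationData W N) (H : HeegnerDatum N (NumberField.discr K)) (ι : K →+* ℂ)
    (P : (W.baseChange K).toAffine.Point)
    (hGZ : gross_zagier N W K) (hKo : kolyvagin N W K) (hmod : hasEntireLFunction_rat)
    (hp5 : 5 ≤ p) (hr : W.analyticRank = 1) (hN : W.conductorNorm ℤ = N)
    (hK : IsImaginaryQuadratic K) (hHN : SatisfiesHeegnerHypothesis N K)
    (hLt : (W.quadraticTwist (NumberField.discr K : ℚ)).entireLFunction 1 ≠ 0)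
    (hP : WeierstrassCurve.Affine.Point.map ι.toRatAlgHom P = heegnerPointComplex Dt H)
    {κ : ZpExtension K p} {𝔭 : HeightOneSpectrum (𝓞 K)} {γ : Field.absoluteGaloisGroup K}
    [Fact (κ.IsTopGenerator γ)] {ιp : K →+* ℚ_[p]}
    (hLC : X11b.ControlOnTreeGoodAt p κ 𝔭 γ ιp P) :
    X11b.IndexLowerBoundAt W p K P ↔ X11b.IMCLowerWaldspurgerOnTreeGoodAt p κ 𝔭 γ ιp P := by
  haveI : Finite (W.baseChange K).sha :=
    X11b.finite_sha_baseChange_of_heegner W N K Dt H ι P hGZ hKo hmod hr hK hHN hLt hP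
  exact (X11b.imcLowerWaldspurgerOnTreeGoodAt_iff_indexLowerBoundAt hp5 hK hN hHN hLC).symm

end Summit.BirchSwinnertonDyer.Rank1Residual.Supersingular

end
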